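import Summits.BirchSwinnertonDyer.BirchSwinnertonDyer.Statement
import Summits.BirchSwinnertonDyer.BirchSwinnertonDyer.Theorems.GoldfeldAllTwistsTwoConverseTwinAdditiveSign
import Summits.BirchSwinnertonDyer.BirchSwinnertonDyer.Theorems.GoldfeldAllTwistsTwoConverseTwinAdditiveInertTwistDescent
import Summits.BirchSwinnertonDyer.BirchSwinnertonDyer.Theorems.GoldfeldAllTwistsTwoConverseTwinAdditiveSplitPrimeTwistDescent
import Summits.BirchSwinnertonDyer.BirchSwinnertonDyer.Theorems.GoldfeldAllTwistsTwoConverseTwinAdditiveTwoInertThreeTwistDescent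
import Summits.BirchSwinnertonDyer.BirchSwinnertonDyer.Theorems.GoldfeldAllTwistsTwoConverseTwinAdditiveTwoSplitFiveTwistDescent
import Summits.BirchSwinnertonDyer.BirchSwinnertonDyer.Theorems.GoldfeldAllTwistsTwoConverseTwinAdditiveTwoInertSevenTwistDescent
import Summits.BirchSwinnertonDyer.BirchSwinnertonDyer.Theorems.GoldfeldAllTwistsTwoConverseTwinAdditiveTwoSplitSevenTwistDescent
import Summits.BirchSwinnertonDyer.BirchSwinnertonDyer.Theorems.GoldfeldAllTwistsTwoConverseTwinAdditiveTwoSplitThreeTwistDescent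
import HarnessLib

set_option linter.dupNamespace false -- namespace `…BirchSwinnertonDyer.BirchSwinnertonDyer…` is the cell's (D-0017 nested layout)
set_option autoImplicit false

/-!
# Route `GoldfeldAllTwistsTwoConverse` (items 19140 / 20044): what the SUMMIT statement `BSDRankConjecture` says on the
# eight descent families of the additive cell — `L′(49a1^{(d)}, 1) ≠ 0` and `rank = 1` for every member

Cell `bsd-goldfeld`, seat `bsd-goldfeld-s1p-c301` (prover, gen 3). Theorems only; no definition, no axiom, no `sorry`.
HONEST FRAMING: nothing about BSD is proved here; this records a CONSEQUENCE of the Clay statement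
`Literature.BSDRankConjecture` (`Summits/BirchSwinnertonDyer/BirchSwinnertonDyer/Statement.lean`: `r_an = rank` for every
elliptic `W/ℚ`) on the infinite families where this cell's 2-isogeny descents give `rank ≤ 1` unconditionally
(seat c301 gen 2 parts VII/IX/XI/XIII/XVI, gen 3 parts XVIII/XX) and this seat's sign theorem gives `w = −1`
(`rootNumber_quadraticTwist_cm7`, so `r_an` is odd): `r_an = rank ≤ 1` and odd, hence

  **`ord_{s=1} L(W, s) = 1` and `rank W(ℚ) = 1` for EVERY model `W` of EVERY member of the families**
  `𝒟₋₁ = 49a1^{(−m)}`, `𝒟₋₂ = 49a1^{(−2m)}` (`m` squarefree of primes `≡ 1 (mod 4)` inert in `ℚ(√−7)`), `49a1^{(−ℓ)}`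
  (`ℓ ≡ 5 (8)` split), `49a1^{(−2ℓ)}` (`ℓ ≡ 3, 7 (8)` inert; `ℓ ≡ 3, 5, 7 (8)` split) —

granted Modularity (`hnf`) and Coates–Li–Tian–Zhai Thm. 1.2 at `R = 1` (`h12`, `w(X₀(49)) = +1`). So on these families the
summit statement alone predicts the non-vanishing `L′(E_d, 1) ≠ 0` (numerically: all `458` members with `|d| ≤ 3000`
have `r_an = 1`, kit tables j248486/j248731); crux K12₂″ predicts the same from `corank = 1`
(`GoldfeldK12AdditiveTwoDescentFamiliesCorank`), and twin″ adds `#Ш_an ∈ ℤ₂^×`. Generic step: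
`analyticRank_eq_one_of_bsdRank_of_rank_le_one_of_neg`.

References: A. Wiles, *The Birch and Swinnerton-Dyer conjecture* (Clay, 2000/2006) [Wiles2000]; M. R. Murty, V. K. Murty
(1997) Ch. 6 §1 [MurtyMurty1997]; J. H. Silverman, *AEC* (2009) X.4.2(a), C.16 [SilvermanAEC2009].
-/

noncomputable section

open scoped Classical

open WeierstrassCurve Literature.NumberTheory.EllipticCurves Literature.NumberTheory.EllipticCurves.ModularForms

namespace Summit.BirchSwinnertonDyer.BirchSwinnertonDyer.Theorems.GoldfeldGoodTwists

/-- **Generic step.** For a model `W ≅ 49a1^{(d)}` with `d < 0` squarefree, `7 ∤ d`, and `rank W(ℚ) ≤ 1` (a complete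
`2`-descent): the summit statement `r_an = rank` forces `r_an(W) = rank W(ℚ) = 1`, since `r_an(W)` is odd
(`odd_analyticRank_of_smul_eq_quadraticTwist_cm7_of_neg`). [cite: Wiles2000] [cite: MurtyMurty1997, Ch. 6 §1] -/
theorem analyticRank_eq_one_of_bsdRank_of_rank_le_one_of_neg (hnf : exists_isNewformOf)
    (h12 : CoatesLiTianZhai2015.thm12_fullBSD_twist) (hBSD : Literature.BSDRankConjecture)
    {d : ℤ} (hsq : Squarefree d) (h7 : ¬ (7 : ℤ) ∣ d) (hd : d < 0) (W : WeierstrassCurve ℚ) [hW : W.IsElliptic]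
    (C : VariableChange ℚ) (hC : C • W = cm7.quadraticTwist (d : ℚ)) (hrank : W.mordellWeilRank ≤ 1) :
    W.analyticRank = 1 ∧ W.mordellWeilRank = 1 := by
  have heq : W.analyticRank = W.mordellWeilRank := hBSD W hW
  obtain ⟨k, hk⟩ := odd_analyticRank_of_smul_eq_quadraticTwist_cm7_of_neg hnf h12 hsq h7 hd W C hC
  omega

/-- Bookkeeping: `−m < 0` squarefree with `7 ∤ −m` for `m ≥ 1` squarefree with inert prime factors. [folklore] -/
theorem neg_natCast_data {m : ℕ} (hm0 : 0 < m) (hmsq : Squarefree m)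
    (hinert : ∀ l : ℕ, l.Prime → l ∣ m → l % 4 = 1 ∧ ¬ IsSquare ((-7 : ℤ) : ZMod l)) :
    Squarefree (-(m : ℤ)) ∧ ¬ (7 : ℤ) ∣ -(m : ℤ) ∧ -(m : ℤ) < 0 := by
  have h7m : ¬ 7 ∣ m := fun h ↦ (hinert 7 (by norm_num) h).2 ⟨0, by decide⟩
  refine ⟨(Int.squarefree_natCast.mpr hmsq).squarefree_of_dvd (neg_dvd.mpr dvd_rfl),
    fun h ↦ h7m (by exact_mod_cast (dvd_neg.mp h)), ?_⟩
  have : (0 : ℤ) < m := by exact_mod_cast hm0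
  omega

/-- Bookkeeping: `−2m < 0` squarefree with `7 ∤ −2m` for the same `m`. [folklore] -/
theorem neg_two_mul_natCast_data {m : ℕ} (hm0 : 0 < m) (hmsq : Squarefree m)
    (hinert : ∀ l : ℕ, l.Prime → l ∣ m → l % 4 = 1 ∧ ¬ IsSquare ((-7 : ℤ) : ZMod l)) :
    Squarefree (-2 * (m : ℤ)) ∧ ¬ (7 : ℤ) ∣ -2 * (m : ℤ) ∧ -2 * (m : ℤ) < 0 := by
  have h7m : ¬ 7 ∣ m := fun h ↦ (hinert 7 (by norm_num) h).2 ⟨0, by decide⟩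
  have h2m : ¬ 2 ∣ m := fun h ↦ by have := (hinert 2 Nat.prime_two h).1; omega
  refine ⟨?_, ?_, ?_⟩
  · have h2 : Squarefree (((2 * m : ℕ) : ℤ)) := Int.squarefree_natCast.mpr
      ((Nat.squarefree_mul ((Nat.prime_two.coprime_iff_not_dvd).mpr h2m)).mpr ⟨Nat.squarefree_two, hmsq⟩)
    exact h2.squarefree_of_dvd ⟨-1, by push_cast; ring⟩
  · intro h
    rcases (Int.Prime.dvd_mul' (by norm_num) h) with h2 | hm
    · norm_num at h2
    · exact h7m (by exact_mod_cast hm)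
  · have : (0 : ℤ) < m := by exact_mod_cast hm0
    omega

/-- **Summit ⟹ `r_an = rank = 1` on `𝒟₋₁ = {49a1^{(−m)}}`** (every model). [cite: Wiles2000] -/
theorem analyticRank_eq_one_inertTwist_of_bsdRank (hnf : exists_isNewformOf)
    (h12 : CoatesLiTianZhai2015.thm12_fullBSD_twist) (hBSD : Literature.BSDRankConjecture)
    {m : ℕ} (hm0 : 0 < m) (hmsq : Squarefree m)
    (hinert : ∀ l : ℕ, l.Prime → l ∣ m → l % 4 = 1 ∧ ¬ IsSquare ((-7 : ℤ) : ZMod l))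
    (W : WeierstrassCurve ℚ) [W.IsElliptic] (C : VariableChange ℚ)
    (hC : C • W = cm7.quadraticTwist ((-m : ℤ) : ℚ)) : W.analyticRank = 1 ∧ W.mordellWeilRank = 1 := by
  obtain ⟨hsq, h7, hd⟩ := neg_natCast_data hm0 hmsq hinert
  exact analyticRank_eq_one_of_bsdRank_of_rank_le_one_of_neg hnf h12 hBSD hsq h7 hd W C hC
    (rank_le_one_and_sha_two_inertTwist hm0 hmsq hinert W C hC).1

/-- **Summit ⟹ `r_an = rank = 1` on `𝒟₋₂ = {49a1^{(−2m)}}`** (every model). [cite: Wiles2000] -/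
theorem analyticRank_eq_one_inertTwoTwist_of_bsdRank (hnf : exists_isNewformOf)
    (h12 : CoatesLiTianZhai2015.thm12_fullBSD_twist) (hBSD : Literature.BSDRankConjecture)
    {m : ℕ} (hm0 : 0 < m) (hmsq : Squarefree m)
    (hinert : ∀ l : ℕ, l.Prime → l ∣ m → l % 4 = 1 ∧ ¬ IsSquare ((-7 : ℤ) : ZMod l))
    (W : WeierstrassCurve ℚ) [W.IsElliptic] (C : VariableChange ℚ)
    (hC : C • W = cm7.quadraticTwist ((-2 * m : ℤ) : ℚ)) : W.analyticRank = 1 ∧ W.mordellWeilRank = 1 := by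
  obtain ⟨hsq, h7, hd⟩ := neg_two_mul_natCast_data hm0 hmsq hinert
  exact analyticRank_eq_one_of_bsdRank_of_rank_le_one_of_neg hnf h12 hBSD hsq h7 hd W C hC
    (rank_le_one_and_sha_two_inertTwoTwist hm0 hmsq hinert W C hC).1

/-- **Summit ⟹ `r_an = rank = 1` on `{49a1^{(−ℓ)} : ℓ ≡ 5 (8) split}`** (every model). [cite: Wiles2000] -/
theorem analyticRank_eq_one_splitPrimeTwist_of_bsdRank (hnf : exists_isNewformOf)
    (h12 : CoatesLiTianZhai2015.thm12_fullBSD_twist) (hBSD : Literature.BSDRankConjecture)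
    {l : ℕ} [Fact l.Prime] (hl8 : l % 8 = 5) (hl7 : legendreSym l (-7) = 1)
    (W : WeierstrassCurve ℚ) [W.IsElliptic] (C : VariableChange ℚ)
    (hC : C • W = cm7.quadraticTwist ((-l : ℤ) : ℚ)) : W.analyticRank = 1 ∧ W.mordellWeilRank = 1 := by
  obtain ⟨hsq, h7, hd, -⟩ := primeTwist_data (by rw [hl7]; decide) W C hC
  exact analyticRank_eq_one_of_bsdRank_of_rank_le_one_of_neg hnf h12 hBSD hsq h7 hd W C hC
    (rank_le_one_and_sha_two_splitPrimeTwist hl8 hl7 W C hC).1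

/-- **Summit ⟹ `r_an = rank = 1` on `{49a1^{(−2ℓ)} : ℓ ≡ 3 (8) inert}`** (every model). [cite: Wiles2000] -/
theorem analyticRank_eq_one_twoInertThreeTwist_of_bsdRank (hnf : exists_isNewformOf)
    (h12 : CoatesLiTianZhai2015.thm12_fullBSD_twist) (hBSD : Literature.BSDRankConjecture)
    {l : ℕ} [Fact l.Prime] (hl8 : l % 8 = 3) (hl7 : legendreSym l (-7) = -1)
    (W : WeierstrassCurve ℚ) [W.IsElliptic] (C : VariableChange ℚ)
    (hC : C • W = cm7.quadraticTwist ((-2 * l : ℤ) : ℚ)) : W.analyticRank = 1 ∧ W.mordellWeilRank = 1 := by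
  obtain ⟨hsq, h7, hd, -⟩ := twoPrimeTwist_data (by rintro rfl; norm_num at hl8) (by rw [hl7]; decide) W C hC
  exact analyticRank_eq_one_of_bsdRank_of_rank_le_one_of_neg hnf h12 hBSD hsq h7 hd W C hC
    (rank_le_one_and_sha_two_twoInertThreeTwist hl8 hl7 W C hC).1

/-- **Summit ⟹ `r_an = rank = 1` on `{49a1^{(−2ℓ)} : ℓ ≡ 5 (8) split}`** (every model). [cite: Wiles2000] -/
theorem analyticRank_eq_one_twoSplitFiveTwist_of_bsdRank (hnf : exists_isNewformOf)
    (h12 : CoatesLiTianZhai2015.thm12_fullBSD_twist) (hBSD : Literature.BSDRankConjecture)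
    {l : ℕ} [Fact l.Prime] (hl8 : l % 8 = 5) (hl7 : legendreSym l (-7) = 1)
    (W : WeierstrassCurve ℚ) [W.IsElliptic] (C : VariableChange ℚ)
    (hC : C • W = cm7.quadraticTwist ((-2 * l : ℤ) : ℚ)) : W.analyticRank = 1 ∧ W.mordellWeilRank = 1 := by
  obtain ⟨hsq, h7, hd, -⟩ := twoPrimeTwist_data (by rintro rfl; norm_num at hl8) (by rw [hl7]; decide) W C hC
  exact analyticRank_eq_one_of_bsdRank_of_rank_le_one_of_neg hnf h12 hBSD hsq h7 hd W C hC
    (rank_le_one_and_sha_two_twoSplitFiveTwist hl8 hl7 W C hC).1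

/-- **Summit ⟹ `r_an = rank = 1` on `{49a1^{(−2ℓ)} : ℓ ≡ 7 (8) inert}`** (every model). [cite: Wiles2000] -/
theorem analyticRank_eq_one_twoInertSevenTwist_of_bsdRank (hnf : exists_isNewformOf)
    (h12 : CoatesLiTianZhai2015.thm12_fullBSD_twist) (hBSD : Literature.BSDRankConjecture)
    {l : ℕ} [Fact l.Prime] (hl8 : l % 8 = 7) (hl7 : legendreSym l (-7) = -1)
    (W : WeierstrassCurve ℚ) [W.IsElliptic] (C : VariableChange ℚ)
    (hC : C • W = cm7.quadraticTwist ((-2 * l : ℤ) : ℚ)) : W.analyticRank = 1 ∧ W.mordellWeilRank = 1 := by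
  obtain ⟨hsq, h7, hd, -⟩ := twoPrimeTwist_data (by rintro rfl; norm_num at hl8) (by rw [hl7]; decide) W C hC
  exact analyticRank_eq_one_of_bsdRank_of_rank_le_one_of_neg hnf h12 hBSD hsq h7 hd W C hC
    (rank_le_one_and_sha_two_twoInertSevenTwist hl8 hl7 W C hC).1

/-- **Summit ⟹ `r_an = rank = 1` on `{49a1^{(−2ℓ)} : ℓ ≡ 7 (8) split}`** (every model). [cite: Wiles2000] -/
theorem analyticRank_eq_one_twoSplitSevenTwist_of_bsdRank (hnf : exists_isNewformOf)
    (h12 : CoatesLiTianZhai2015.thm12_fullBSD_twist) (hBSD : Literature.BSDRankConjecture)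
    {l : ℕ} [Fact l.Prime] (hl8 : l % 8 = 7) (hl7 : legendreSym l (-7) = 1)
    (W : WeierstrassCurve ℚ) [W.IsElliptic] (C : VariableChange ℚ)
    (hC : C • W = cm7.quadraticTwist ((-2 * l : ℤ) : ℚ)) : W.analyticRank = 1 ∧ W.mordellWeilRank = 1 := by
  obtain ⟨hsq, h7, hd, -⟩ := twoPrimeTwist_data (by rintro rfl; norm_num at hl8) (by rw [hl7]; decide) W C hC
  exact analyticRank_eq_one_of_bsdRank_of_rank_le_one_of_neg hnf h12 hBSD hsq h7 hd W C hC
    (rank_le_one_and_sha_two_twoSplitSevenTwist hl8 hl7 W C hC).1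

/-- **Summit ⟹ `r_an = rank = 1` on `{49a1^{(−2ℓ)} : ℓ ≡ 3 (8) split}`** (every model). [cite: Wiles2000] -/
theorem analyticRank_eq_one_twoSplitThreeTwist_of_bsdRank (hnf : exists_isNewformOf)
    (h12 : CoatesLiTianZhai2015.thm12_fullBSD_twist) (hBSD : Literature.BSDRankConjecture)
    {l : ℕ} [Fact l.Prime] (hl8 : l % 8 = 3) (hl7 : legendreSym l (-7) = 1)
    (W : WeierstrassCurve ℚ) [W.IsElliptic] (C : VariableChange ℚ)
    (hC : C • W = cm7.quadraticTwist ((-2 * l : ℤ) : ℚ)) : W.analyticRank = 1 ∧ W.mordellWeilRank = 1 := by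
  obtain ⟨hsq, h7, hd, -⟩ := twoPrimeTwist_data (by rintro rfl; norm_num at hl8) (by rw [hl7]; decide) W C hC
  exact analyticRank_eq_one_of_bsdRank_of_rank_le_one_of_neg hnf h12 hBSD hsq h7 hd W C hC
    (rank_le_one_and_sha_two_twoSplitThreeTwist hl8 hl7 W C hC).1

end Summit.BirchSwinnertonDyer.BirchSwinnertonDyer.Theorems.GoldfeldGoodTwists

end
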